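import Summits.CriticalPhenomena.SAWScalingLimit.Theorems.SAWCompassLatticeSurfaceUniversalityApproxDefs

/-!
# The site dictionary: stub `stub_siteDictionary` (line `registered` v6) of the crux
# `SAWCompassLattice.SurfaceUniversality` (stmt-CriticalPhenomena-6964)

Route `SAWCompassLattice` (sub-problem `SAWScalingLimit`). For `δ > 0` and `a ∈ Ω_δ`, the critical `ℤ²` SAW
law `SAW.law Ω δ a b` drawn through the mesh points and the critical plus path law `plusPathLaw (probeSupport
siteRule Ω δ) δ (siteCentre a) (siteCentre b)` differ by `≤ L·δ` on bounded `L`-Lipschitz test functions: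
`plusOfWalk` (`x₀…xₙ ↦ centre x₀, port(x₀,x₁), centre x₁, …, centre xₙ`) is a weight-preserving (`(√x_c)^{2n} =
x_c^n`) bijection from the SAWs of `Ω_δ` from `a` onto the self-avoiding plus paths from `siteCentre a` through
the site support (`toSitePath_bijective`: the site rule keeps the centre of `x` iff `δx ∈ Ω` and the port `e`
iff the closed rescaled edge of `portSites e` lies in `closure Ω`; plus paths alternate centre / port, two
consecutive centres are the two sites of the port between them, and `Ω_δ` is a union of mesh components), so
the plus path law is `SAW.law` pushed along the plus drawing (`plusPathLaw_eq_map`), `δ`-close to the site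
drawing (`dist_curve_plusOfWalk_le`, by `PortTransfer.mk_polyline_stay` / `dist_mk_polyline_le`); conclude by
`PortTransfer.norm_integral_sub_integral_le`. Tagged [folklore] (bookkeeping).
-/

noncomputable section

namespace Summit.CriticalPhenomena.SAWScalingLimit.Theorems.SurfaceUniversality

open MeasureTheory Filter Topology Set Metric
open scoped NNReal ENNReal BoundedContinuousFunction
open Literature.Probability.RandomPlanarGeometry Literature.Probability.RandomPlanarGeometry.SAW
  Literature.Probability.RandomPlanarGeometry.SAW.YangBaxter Literature.Probability.LatticeModels
open Summit.CriticalPhenomena.SAWScalingLimit.Cruxes.HexTransfer.Sketch (PortTransfer.stay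
  PortTransfer.stay_cons_some PortTransfer.stay_cons_none PortTransfer.mk_polyline_stay
  PortTransfer.dist_mk_polyline_le PortTransfer.norm_integral_sub_integral_le)
open Summit.CriticalPhenomena.SAWScalingLimit.Cruxes.HexTransfer.Sketch.Surface (planeCorner_rightAngles colShift_rightAngles)
open Complex (I)

/-- The two sites of the `ℤ²`-edge subdivided by a port (west / south endpoint first). [folklore] -/
def portSites : MidEdge → Site 2 × Site 2
  | .vert k j => (![k - 1, j], ![k, j])
  | .slant k j => (![k, j - 1], ![k, j])

/-- The port subdividing the `ℤ²`-edge between two nearest neighbours (junk otherwise). [folklore] -/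
def sitePort (x z : Site 2) : MidEdge :=
  if x 0 = z 0 then .slant (x 0) (max (x 1) (z 1)) else .vert (max (x 0) (z 0)) (x 1)

variable {Ω : Set ℂ} {δ : ℝ}

/-- The two sites of a port are nearest neighbours. [folklore] -/
theorem zdGraph_adj_portSites (e : MidEdge) : (zdGraph 2).Adj (portSites e).1 (portSites e).2 := by
  refine (zdGraph_adj_iff _ _).2 ?_
  cases e
  exacts [⟨0, Or.inl (by funext i; fin_cases i <;> simp [portSites])⟩,
    ⟨1, Or.inl (by funext i; fin_cases i <;> simp [portSites])⟩]

/-- `sitePort` recovers the port from its two sites, in either order. [folklore] -/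
theorem sitePort_portSites (e : MidEdge) :
    sitePort (portSites e).1 (portSites e).2 = e ∧ sitePort (portSites e).2 (portSites e).1 = e := by
  cases e <;> simp [sitePort, portSites]
  omega

/-- The sites of the port between the two ends of an edge of `Ω_δ` are those two sites. [folklore] -/
theorem portSites_sitePort {x z : Site 2} (h : (discreteDomainGraph Ω δ).Adj x z) :
    portSites (sitePort x z) = (x, z) ∨ portSites (sitePort x z) = (z, x) := by
  obtain ⟨i, rfl | rfl⟩ := (zdGraph_adj_iff x z).1 (meshGraph_le_zdGraph _ _ (discreteDomainGraph_le_meshGraph _ _ h)) <;>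
    fin_cases i <;> simp [sitePort, portSites, Prod.ext_iff, funext_iff, Fin.forall_fin_two]

/-- A port is plus-adjacent to the centres of its two sites. [folklore] -/
theorem plusLattice_adj_portSites (e : MidEdge) : plusLattice.Adj (siteCentre (portSites e).1) (Sum.inl e) ∧
    plusLattice.Adj (siteCentre (portSites e).2) (Sum.inl e) := by
  cases e
  exacts [⟨(plusLattice_adj_inr_inl _ _ _).2 ⟨.E, by simp [siteFace, portSites, Face.side]⟩,
      (plusLattice_adj_inr_inl _ _ _).2 ⟨.W, by simp [siteFace, portSites, Face.side]⟩⟩,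
    ⟨(plusLattice_adj_inr_inl _ _ _).2 ⟨.N, by simp [siteFace, portSites, Face.side]⟩,
      (plusLattice_adj_inr_inl _ _ _).2 ⟨.S, by simp [siteFace, portSites, Face.side]⟩⟩]

/-- Centre — port — centre: the two plus edges standing for the edge `x — z` of `Ω_δ`. [folklore] -/
theorem adj_sitePort {x z : Site 2} (h : (discreteDomainGraph Ω δ).Adj x z) :
    plusLattice.Adj (siteCentre x) (Sum.inl (sitePort x z)) ∧ plusLattice.Adj (Sum.inl (sitePort x z)) (siteCentre z) := by
  have h1 := plusLattice_adj_portSites (sitePort x z)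
  rcases portSites_sitePort h with he | he <;> rw [he] at h1
  exacts [⟨h1.1, h1.2.symm⟩, ⟨h1.2, h1.1.symm⟩]

/-- A site whose face has the port `e` as a side is one of the two sites of `e`. [folklore] -/
theorem eq_portSites_of_side_eq {x : Site 2} {s : Side} {e : MidEdge} (h : (siteFace x).side s = e) :
    x = (portSites e).1 ∨ x = (portSites e).2 := by
  subst h
  have hx : x = ![x 0, x 1] := by funext i; fin_cases i <;> rfl
  cases s <;> simp [siteFace, Face.side, portSites, ← hx]

/-- Two DISTINCT sites whose faces share the side `e` are the two sites of `e`. [folklore] -/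
theorem portSites_eq_of_sides {x z : Site 2} {s t : Side} {e : MidEdge} (hs : (siteFace x).side s = e)
    (ht : (siteFace z).side t = e) (hxz : x ≠ z) : portSites e = (x, z) ∨ portSites e = (z, x) := by
  rcases eq_portSites_of_side_eq hs with hx | hx <;> rcases eq_portSites_of_side_eq ht with hz | hz
  exacts [absurd (hx.trans hz.symm) hxz, Or.inl (Prod.ext hx.symm hz.symm),
    Or.inr (Prod.ext hz.symm hx.symm), absurd (hx.trans hz.symm) hxz]

/-- Testing a rescaled translated segment pointwise is testing the image segment. [folklore] -/
theorem forall_segment_iff {r c p q p' q' : ℂ} {T : Set ℂ} (hp : r * (c + p) = p')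
    (hq : r * (c + q) = q') : (∀ z ∈ segment ℝ p q, r * (c + z) ∈ T) ↔ segment ℝ p' q' ⊆ T := by
  subst hp hq
  rw [segment_eq_image_lineMap, segment_eq_image_lineMap, Set.image_subset_iff, Set.forall_mem_image]
  refine forall₂_congr fun t _ => ?_
  rw [Set.mem_preimage, AffineMap.lineMap_apply_module, AffineMap.lineMap_apply_module,
    show r * (c + ((1 - t) • p + t • q)) = (1 - t) • (r * (c + p)) + t • (r * (c + q)) by
      simp only [Complex.real_smul]; push_cast; ring]

/-- The site rule keeps the centre of `x` iff `x` is a mesh vertex (the probe point is `δ x`). [folklore] -/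
theorem siteCentre_mem_siteSupport_iff {x : Site 2} :
    siteCentre x ∈ probeSupport siteRule Ω δ ↔ x ∈ meshVertices Ω δ := by
  rw [mem_meshVertices_iff, eq_sub_of_add_eq (embed_siteCentre δ x).symm, mem_probeSupport_iff]
  simp only [siteCentre, ProbeRule.probesAt_inr, siteRule, List.mem_singleton, exists_eq_left,
    Set.mem_singleton_iff, forall_eq, probeTarget]
  exact (congrArg (· ∈ Ω) (by ring)).to_iff

/-- The site rule keeps a port iff the closed rescaled `ℤ²`-edge it subdivides lies in `closure Ω`. [folklore] -/
theorem inl_mem_siteSupport_iff {e : MidEdge} : (Sum.inl e : PVert) ∈ probeSupport siteRule Ω δ ↔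
    segment ℝ (meshPoint δ (portSites e).1) (meshPoint δ (portSites e).2) ⊆ closure Ω := by
  rw [mem_probeSupport_iff]
  cases e <;> simp only [ProbeRule.probesAt_vert, ProbeRule.probesAt_slant, siteRule, List.mem_singleton,
    exists_eq_left, probeTarget] <;> refine forall_segment_iff ?_ ?_ <;>
    simp only [portSites, meshPoint_vec, PortGadget.embed, planeMidpoint, planeCorner_rightAngles,
      colShift_rightAngles] <;> push_cast <;> ring

/-- **The plus walk of a site walk**: `x₀…xₙ ↦ centre x₀, port(x₀,x₁), centre x₁, …, centre xₙ`. [folklore] -/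
def plusOfWalk : ∀ {x y : Site 2}, (discreteDomainGraph Ω δ).Walk x y → plusLattice.Walk (siteCentre x) (siteCentre y)
  | _, _, .nil => .nil
  | _, _, .cons h q => .cons (adj_sitePort h).1 (.cons (adj_sitePort h).2 (plusOfWalk q))

/-- The support of the plus walk of `x :: q`. [folklore] -/
theorem support_plusOfWalk_cons {x z y : Site 2} (h : (discreteDomainGraph Ω δ).Adj x z)
    (q : (discreteDomainGraph Ω δ).Walk z y) : (plusOfWalk (.cons h q)).support =
      siteCentre x :: Sum.inl (sitePort x z) :: (plusOfWalk q).support := rfl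

/-- The plus walk has twice as many darts. [folklore] -/
theorem length_plusOfWalk : ∀ {x y : Site 2} (q : (discreteDomainGraph Ω δ).Walk x y),
    (plusOfWalk q).length = 2 * q.length
  | _, _, .nil => rfl
  | _, _, .cons h q => by simp only [plusOfWalk, SimpleGraph.Walk.length_cons, length_plusOfWalk q]; ring

/-- The centres of the plus walk are the centres of the sites of the walk. [folklore] -/
theorem map_siteCentre_support : ∀ {x y : Site 2} (q : (discreteDomainGraph Ω δ).Walk x y),
    q.support.map siteCentre = (plusOfWalk q).support.filter Sum.isRight
  | _, _, .nil => by simp [plusOfWalk, siteCentre]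
  | _, _, .cons h q => by
    rw [support_plusOfWalk_cons, SimpleGraph.Walk.support_cons, List.map_cons, map_siteCentre_support q]
    simp [siteCentre]

/-- `plusOfWalk` is injective. [folklore] -/
theorem plusOfWalk_injective {x y : Site 2} :
    Function.Injective (plusOfWalk (Ω := Ω) (δ := δ) (x := x) (y := y)) := fun q q' h =>
  SimpleGraph.Walk.support_injective ((List.map_injective_iff.2 siteCentre_injective)
    (by rw [map_siteCentre_support, map_siteCentre_support, h]))

/-- A centre lies on the plus walk iff its site lies on the walk. [folklore] -/
theorem siteCentre_mem_support_iff {x y v : Site 2} (q : (discreteDomainGraph Ω δ).Walk x y) :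
    siteCentre v ∈ (plusOfWalk q).support ↔ v ∈ q.support := by
  rw [← List.mem_map_of_injective siteCentre_injective, map_siteCentre_support, List.mem_filter]
  simp [siteCentre]

/-- A port on the plus walk subdivides an edge between two sites of the walk. [folklore] -/
theorem portSites_mem_support : ∀ {x y : Site 2} (q : (discreteDomainGraph Ω δ).Walk x y) {e : MidEdge},
    Sum.inl e ∈ (plusOfWalk q).support → (portSites e).1 ∈ q.support ∧ (portSites e).2 ∈ q.support
  | _, _, .nil, e, he => by simp [plusOfWalk, siteCentre] at he
  | x, _, .cons (v := z) h q, e, he => by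
    rw [support_plusOfWalk_cons, List.mem_cons, List.mem_cons, SimpleGraph.Walk.support_cons] at *
    rcases he with he | he | he
    · exact absurd he Sum.inl_ne_inr
    · rw [Sum.inl.injEq] at he
      subst he
      rcases portSites_sitePort h with hp | hp <;> rw [hp] <;> simp [q.start_mem_support]
    · exact ⟨List.mem_cons_of_mem _ (portSites_mem_support q he).1,
        List.mem_cons_of_mem _ (portSites_mem_support q he).2⟩

/-- **The plus walk of a self-avoiding walk is self-avoiding.** [folklore] -/
theorem isPath_plusOfWalk : ∀ {x y : Site 2} {q : (discreteDomainGraph Ω δ).Walk x y},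
    q.IsPath → (plusOfWalk q).IsPath
  | _, _, .nil, _ => SimpleGraph.Walk.IsPath.nil
  | x, _, .cons (v := z) h q, hq => by
    rw [SimpleGraph.Walk.cons_isPath_iff] at hq
    rw [plusOfWalk, SimpleGraph.Walk.cons_isPath_iff, SimpleGraph.Walk.cons_isPath_iff, SimpleGraph.Walk.support_cons,
      List.mem_cons, not_or]
    refine ⟨⟨isPath_plusOfWalk hq.1, fun hmem => ?_⟩, Sum.inr_ne_inl, fun hmem => hq.2 ((siteCentre_mem_support_iff q).1 hmem)⟩
    have hb := portSites_mem_support q hmem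
    rcases portSites_sitePort h with hp | hp <;> rw [hp] at hb
    exacts [hq.2 hb.1, hq.2 hb.2]

/-- **The plus walk of a walk of `Ω_δ` from a site of `Ω_δ` lies in the site support.** [folklore] -/
theorem support_plusOfWalk_subset : ∀ {x y : Site 2} (q : (discreteDomainGraph Ω δ).Walk x y),
    x ∈ meshDomain Ω δ → ∀ v ∈ (plusOfWalk q).support, v ∈ probeSupport siteRule Ω δ
  | x, _, .nil, hx, v, hv => by
    rw [plusOfWalk, SimpleGraph.Walk.support_nil, List.mem_singleton] at hv
    exact hv ▸ siteCentre_mem_siteSupport_iff.2 (meshDomain_subset_meshVertices _ _ hx)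
  | x, _, .cons (v := z) h q, hx, v, hv => by
    obtain ⟨hm, -, hz⟩ := discreteDomainGraph_adj_iff.1 h
    rw [support_plusOfWalk_cons, List.mem_cons, List.mem_cons] at hv
    rcases hv with rfl | rfl | hv
    · exact siteCentre_mem_siteSupport_iff.2 (meshDomain_subset_meshVertices _ _ hx)
    · rw [inl_mem_siteSupport_iff]
      rcases portSites_sitePort h with hp | hp <;> rw [hp]
      exacts [(meshGraph_adj_iff.1 hm).2, (segment_symm ℝ _ _).trans_subset (meshGraph_adj_iff.1 hm).2]
    · exact support_plusOfWalk_subset q hz v hv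

/-- **Every self-avoiding plus path between two centres through the site support, from the centre of a site
of `Ω_δ`, is the plus walk of a self-avoiding walk of `Ω_δ`** (it alternates centre / port; two consecutive
centres are the two sites of the port between them, whose probe is the mesh edge; `mem_meshDomain_of_adj`).
[folklore] -/
theorem exists_plusOfWalk_eq : ∀ {u w : PVert} (p : plusLattice.Walk u w) (x : Site 2)
    (hu : siteCentre x = u) (y : Site 2) (hw : siteCentre y = w), p.IsPath →
    (∀ v ∈ p.support, v ∈ probeSupport siteRule Ω δ) → x ∈ meshDomain Ω δ →
    ∃ q : (discreteDomainGraph Ω δ).Walk x y, q.IsPath ∧ (plusOfWalk q).copy hu hw = p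
  | _, _, .nil, x, hu, y, hw, _, _, _ => by
    subst hu
    obtain rfl := siteCentre_injective hw
    exact ⟨.nil, SimpleGraph.Walk.IsPath.nil, rfl⟩
  | _, _, .cons (v := .inr (_, _)) h _, x, hu, _, _, _, _, _ => by
    subst hu
    exact absurd h (plusLattice_adj_inr_inr _ _ _ _)
  | _, _, .cons (v := .inl _) _ .nil, _, _, y, hw, _, _, _ => absurd hw Sum.inr_ne_inl
  | _, _, .cons (v := .inl _) _ (.cons (v := .inl _) h' _), _, _, _, _, _, _, _ =>
    absurd h' (PortGadget.lattice_adj_inl_inl _ _ _)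
  | _, _, .cons (v := .inl e) h (.cons (v := .inr ((k, j), ())) h' p''), x, hu, y, hw, hp, hS, hx => by
    subst hu
    rw [SimpleGraph.Walk.cons_isPath_iff, SimpleGraph.Walk.cons_isPath_iff] at hp
    have hxz : x ≠ ![k, j] := fun hxz =>
      hp.2 (by rw [SimpleGraph.Walk.support_cons, hxz]; exact List.mem_cons_of_mem _ p''.start_mem_support)
    obtain ⟨s, hs⟩ := (plusLattice_adj_inr_inl _ _ _).1 h
    obtain ⟨t, ht⟩ := (plusLattice_adj_inl_inr _ _ _).1 h'
    have hS' : ∀ v ∈ p''.support, v ∈ probeSupport siteRule Ω δ := fun v hv => hS v (.tail _ (.tail _ hv))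
    have he : (Sum.inl e : PVert) ∈ probeSupport siteRule Ω δ := hS _ (.tail _ (.head _))
    rw [inl_mem_siteSupport_iff] at he
    have hzV : (![k, j] : Site 2) ∈ meshVertices Ω δ :=
      (siteCentre_mem_siteSupport_iff (x := ![k, j])).1 (hS' _ p''.start_mem_support)
    have hadj : (zdGraph 2).Adj x ![k, j] ∧
        segment ℝ (meshPoint δ x) (meshPoint δ ![k, j]) ⊆ closure Ω ∧ sitePort x ![k, j] = e := by
      have h1 := zdGraph_adj_portSites e
      have h2 := sitePort_portSites e
      rcases portSites_eq_of_sides (z := ![k, j]) hs ht hxz with hq | hq <;> rw [hq] at h1 h2 he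
      exacts [⟨h1, he, h2.1⟩, ⟨h1.symm, (segment_symm ℝ _ _).trans_subset he, h2.2⟩]
    obtain ⟨hzd, hseg, hpe⟩ := hadj
    have hmesh : (meshGraph Ω δ).Adj x ![k, j] := meshGraph_adj_iff.2 ⟨hzd, hseg⟩
    have hzD : (![k, j] : Site 2) ∈ meshDomain Ω δ := mem_meshDomain_of_adj
      (u := ⟨x, meshDomain_subset_meshVertices _ _ hx⟩) (w := ⟨![k, j], hzV⟩) hx (SimpleGraph.induce_adj.2 hmesh)
    have hD : (discreteDomainGraph Ω δ).Adj x ![k, j] := discreteDomainGraph_adj_iff.2 ⟨hmesh, hx, hzD⟩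
    obtain ⟨q'', hq''path, hq''⟩ := exists_plusOfWalk_eq p'' ![k, j] rfl y hw hp.1.1 hS' hzD
    subst hw hpe hq''
    refine ⟨.cons hD q'', (SimpleGraph.Walk.cons_isPath_iff _ _).2 ⟨hq''path, fun hxq => hp.2 ?_⟩, rfl⟩
    rw [SimpleGraph.Walk.support_cons]
    exact List.mem_cons_of_mem _ ((siteCentre_mem_support_iff q'').2 hxq)

/-- Scaling a difference of norm `≤ 1` by `δ ≥ 0`. [folklore] -/
theorem dist_mul_le (hδ : 0 ≤ δ) {p q w : ℂ} (h : p - q = w) (hw : ‖w‖ ≤ 1) :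
    dist ((δ : ℂ) * p) ((δ : ℂ) * q) ≤ δ := by
  rw [dist_eq_norm, ← mul_sub, h, norm_mul, Complex.norm_real, Real.norm_eq_abs, abs_of_nonneg hδ]
  exact mul_le_of_le_one_right hδ hw

/-- A port is drawn within `δ` of both sites of its edge (`vert k j` AT `δ ![k, j]`). [folklore] -/
theorem dist_embed_inl_le (hδ : 0 ≤ δ) (e : MidEdge) :
    dist ((δ : ℂ) * PortGadget.embed plusPos (Sum.inl e : PVert)) (meshPoint δ (portSites e).1) ≤ δ ∧
      dist ((δ : ℂ) * PortGadget.embed plusPos (Sum.inl e : PVert)) (meshPoint δ (portSites e).2) ≤ δ := by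
  have habs : |(1 / 2 : ℝ)| ≤ 1 / 2 := by rw [abs_of_pos (by norm_num)]
  have habs' : |(-(1 / 2) : ℝ)| ≤ 1 / 2 := by rw [abs_neg, abs_of_pos (by norm_num)]
  cases e with
  | vert k j =>
    simp only [portSites, meshPoint_vec, PortGadget.embed, planeMidpoint_rightAngles_vert]
    exact ⟨dist_mul_le hδ (w := 1) (by push_cast; ring) (by simp), dist_mul_le hδ (w := 0) (by ring) (by simp)⟩
  | slant k j =>
    simp only [portSites, meshPoint_vec, PortGadget.embed, planeMidpoint, planeCorner_rightAngles, colShift_rightAngles]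
    exact ⟨dist_mul_le hδ (w := ((1 / 2 : ℝ) : ℂ) + ((1 / 2 : ℝ) : ℂ) * I) (by push_cast; ring)
        (norm_le_one_of_abs_le habs habs), dist_mul_le hδ (w := ((1 / 2 : ℝ) : ℂ) + ((-(1 / 2) : ℝ) : ℂ) * I)
        (by push_cast; ring) (norm_le_one_of_abs_le habs habs')⟩

/-- A centre is drawn at distance `δ/2 ≤ δ` from its site. [folklore] -/
theorem dist_embed_siteCentre_le (hδ : 0 ≤ δ) (x : Site 2) :
    dist ((δ : ℂ) * PortGadget.embed plusPos (siteCentre x)) (meshPoint δ x) ≤ δ :=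
  dist_mul_le hδ (w := 1 / 2) (by
    apply Complex.ext <;>
      simp [siteCentre, siteFace, PortGadget.embed, plusPos, Site.toComplex, planeCorner_rightAngles])
    (by norm_num)

/-- The pairing list: after the step to `z`, the point `δ z` (for the port) and a rest (for the centre). [folklore] -/
def stayPts : ∀ {x y : Site 2}, (discreteDomainGraph Ω δ).Walk x y → List (Option ℂ)
  | _, _, .nil => []
  | _, _, .cons (v := z) _ q => some (meshPoint δ z) :: none :: stayPts q

/-- The points of `stayPts q` are the mesh points of the sites of `q` after the first. [folklore] -/
theorem reduceOption_stayPts : ∀ {x y : Site 2} (q : (discreteDomainGraph Ω δ).Walk x y),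
    (stayPts q).reduceOption = q.support.tail.map (meshPoint δ)
  | _, _, .nil => rfl
  | _, _, .cons (v := z) _ q => by
    rw [stayPts, List.reduceOption_cons_of_some, List.reduceOption_cons_of_none, reduceOption_stayPts q,
      SimpleGraph.Walk.support_cons, List.tail_cons]
    conv_rhs => rw [← q.cons_tail_support, List.map_cons]

/-- **The coupling, vertex by vertex**: port(x,z) and centre z are drawn within `δ` of `δ z`. [folklore] -/
theorem forall₂_stayPts (hδ : 0 ≤ δ) : ∀ {x y : Site 2} (q : (discreteDomainGraph Ω δ).Walk x y),
    List.Forall₂ (fun v w => dist ((δ : ℂ) * PortGadget.embed plusPos v) w ≤ δ)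
      (plusOfWalk q).support.tail (PortTransfer.stay (meshPoint δ x) (stayPts q))
  | _, _, .nil => List.Forall₂.nil
  | x, _, .cons (v := z) h q => by
    rw [support_plusOfWalk_cons, List.tail_cons, stayPts, PortTransfer.stay_cons_some, PortTransfer.stay_cons_none,
      ← (plusOfWalk q).cons_tail_support]
    have hd := dist_embed_inl_le hδ (sitePort x z)
    refine List.Forall₂.cons ?_ (List.Forall₂.cons (dist_embed_siteCentre_le hδ z) (forall₂_stayPts hδ q))
    rcases portSites_sitePort h with hp | hp <;> rw [hp] at hd
    exacts [hd.2, hd.1]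

/-- **The `O(δ)` coupling**: the site drawing of a walk of `Ω_δ` and the plus drawing of its plus walk are
`δ`-close in `CurveClass ℂ` (the polyline through `δx₀; δx₁, δx₁; …` IS the site polyline). [folklore] -/
theorem dist_curve_plusOfWalk_le (hδ : 0 ≤ δ) {x y : Site 2} (q : (discreteDomainGraph Ω δ).Walk x y) :
    dist (CurveClass.mk ⟨q.toCurve (meshPoint δ)⟩)
      (CurveClass.mk ⟨(plusOfWalk q).toCurve fun v => (δ : ℂ) * PortGadget.embed plusPos v⟩) ≤ δ := by
  have h1 : CurveClass.mk ⟨q.toCurve (meshPoint δ)⟩ = CurveClass.mk (E := ℂ)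
      ⟨polyline (meshPoint δ x :: PortTransfer.stay (meshPoint δ x) (stayPts q))⟩ := by
    rw [PortTransfer.mk_polyline_stay, reduceOption_stayPts, ← List.map_cons, q.cons_tail_support]
    rfl
  rw [h1, dist_comm]
  unfold SimpleGraph.Walk.toCurve
  rw [← (plusOfWalk q).cons_tail_support, List.map_cons]
  refine PortTransfer.dist_mk_polyline_le hδ (List.Forall₂.cons (dist_embed_siteCentre_le hδ x) ?_)
  rw [List.forall₂_map_left_iff]
  exact forall₂_stayPts hδ q

/-- The self-avoiding plus paths between two site centres through the site support. [folklore] -/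
abbrev SitePath (Ω : Set ℂ) (δ : ℝ) (a b : Site 2) : Type :=
  {p : plusLattice.Walk (siteCentre a) (siteCentre b) // p.IsPath ∧ ∀ v ∈ p.support, v ∈ probeSupport siteRule Ω δ}

variable {a b : Site 2}

/-- **The site dictionary**: the plus path of a SAW of `Ω_δ` from a site of `Ω_δ`. [folklore] -/
def toSitePath (ha : a ∈ meshDomain Ω δ) (γ : DomainSAW Ω δ a b) : SitePath Ω δ a b :=
  ⟨plusOfWalk γ.walk, isPath_plusOfWalk γ.isPath, support_plusOfWalk_subset γ.walk ha⟩

/-- **The site dictionary is a bijection.** [folklore] -/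
theorem toSitePath_bijective (ha : a ∈ meshDomain Ω δ) : Function.Bijective (toSitePath ha (b := b)) := by
  refine ⟨fun γ γ' h => ?_, fun p => ?_⟩
  · have h' := plusOfWalk_injective (congrArg Subtype.val h)
    cases γ; cases γ'; cases h'; rfl
  · obtain ⟨q, hq, hqp⟩ := exists_plusOfWalk_eq p.1 a rfl b rfl p.2.1 p.2.2 ha
    exact ⟨⟨q, hq⟩, Subtype.ext hqp⟩

/-- The plus drawing at mesh `δ'` of a site path. [folklore] -/
def siteDraw (δ' : ℝ) (p : SitePath Ω δ a b) : CurveClass ℂ :=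
  CurveClass.mk ⟨p.1.toCurve fun v => (δ' : ℂ) * PortGadget.embed plusPos v⟩

/-- **The dictionary preserves weights**: `(√x_c)^{2n} = x_c^n` (`x_c = 1/μ ≥ 0`). [folklore] -/
theorem walkWeight_toSitePath (ha : a ∈ meshDomain Ω δ) (γ : DomainSAW Ω δ a b) :
    PortGadget.walkWeight (plusFugacity (Real.sqrt SAW.criticalFugacity)) (toSitePath ha γ).1 =
      SAW.criticalFugacity ^ γ.length := by
  have hxc : 0 ≤ SAW.criticalFugacity := inv_nonneg.2 (Real.iInf_nonneg fun _ => Real.rpow_nonneg (Nat.cast_nonneg _) _)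
  change PortGadget.walkWeight _ (plusOfWalk γ.walk) = _
  rw [walkWeight_plusFugacity, length_plusOfWalk, pow_mul, Real.sq_sqrt hxc]
  rfl

/-- **The plus path law through the site support is `SAW.law` pushed forward along the plus drawing of
the dictionary** (reindex `pathMeasure` along the bijection; same total mass, same junk). [folklore] -/
theorem plusPathLaw_eq_map (ha : a ∈ meshDomain Ω δ) : plusPathLaw (probeSupport siteRule Ω δ) δ (siteCentre a) (siteCentre b) =
    (SAW.law Ω δ a b).map fun γ => siteDraw δ (toSitePath ha γ) := by
  have key : PortGadget.pathMeasure plusLattice (plusFugacity (Real.sqrt SAW.criticalFugacity))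
      (PortGadget.embed plusPos) (probeSupport siteRule Ω δ) δ (siteCentre a) (siteCentre b) =
      (SAW.weight Ω δ a b).map fun γ => siteDraw δ (toSitePath ha γ) := by
    rw [SAW.weight, Measure.map_sum (DomainSAW.measurable_of_top _).aemeasurable]
    unfold PortGadget.pathMeasure
    rw [← Measure.sum_comp_equiv (Equiv.ofBijective _ (toSitePath_bijective ha))]
    congr 1
    funext γ
    rw [Measure.map_smul, Measure.map_dirac' (DomainSAW.measurable_of_top _), Function.comp_apply,
      Equiv.ofBijective_apply, walkWeight_toSitePath]
    rfl
  rw [plusPathLaw, PortGadget.pathLaw, SAW.law, Measure.map_smul, key,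
    Measure.map_apply (DomainSAW.measurable_of_top _) MeasurableSet.univ, Set.preimage_univ]

/-- `SAW.law` is `0` (junk) or a probability measure. [folklore] -/
theorem law_zero_or_prob : SAW.law Ω δ a b = 0 ∨ IsProbabilityMeasure (SAW.law Ω δ a b) := by
  unfold SAW.law
  by_cases h0 : SAW.weight Ω δ a b Set.univ = 0
  · exact Or.inl (by rw [Measure.measure_univ_eq_zero.1 h0, smul_zero])
  by_cases htop : SAW.weight Ω δ a b Set.univ = ⊤
  · exact Or.inl (by rw [htop, ENNReal.inv_top, zero_smul])
  · exact Or.inr ⟨by rw [Measure.smul_apply, smul_eq_mul, ENNReal.inv_mul_cancel h0 htop]⟩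

/-- Stub `stub_siteDictionary` of the line `registered` (skeleton v6), crux `SAWCompassLattice.SurfaceUniversality`
(stmt-CriticalPhenomena-6964): **the site dictionary** — for `δ > 0` and `a ∈ Ω_δ` (boundedness of `Ω` is not
used) the critical `ℤ²` SAW law pushed to curves and the critical plus path law through the site support from
`siteCentre a` to `siteCentre b` are within `L·δ` on bounded `L`-Lipschitz test functions. [folklore] -/
theorem stub_siteDictionary : ∀ (Ω : Set ℂ) (δ : ℝ) (a b : Site 2), Bornology.IsBounded Ω → 0 < δ → a ∈ meshDomain Ω δ → ∀ (f : BoundedContinuousFunction (CurveClass ℂ) ℝ) (L : ℝ≥0), LipschitzWith L f → ‖(∫ γ, f γ.curve ∂(SAW.law Ω δ a b)) - ∫ x, f x ∂(plusPathLaw (probeSupport siteRule Ω δ) δ (siteCentre a) (siteCentre b))‖ ≤ L * δ := by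
  intro Ω δ a b _ hδ ha f L hf
  rw [plusPathLaw_eq_map ha, integral_map (DomainSAW.measurable_of_top _).aemeasurable f.continuous.aestronglyMeasurable]
  have key := PortTransfer.norm_integral_sub_integral_le (ε := δ) law_zero_or_prob
    (Y := fun γ : DomainSAW Ω δ a b => γ.curve) (Y' := fun γ => siteDraw δ (toSitePath ha γ))
    (DomainSAW.measurable_of_top _).aemeasurable (DomainSAW.measurable_of_top _).aemeasurable f hf
    fun γ => dist_curve_plusOfWalk_le hδ.le γ.walk
  rwa [abs_of_pos hδ] at key

end Summit.CriticalPhenomena.SAWScalingLimit.Theorems.SurfaceUniversality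

end
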